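import Mathlib.Analysis.SpecialFunctions.Log.Basic
import Mathlib.Analysis.SpecialFunctions.Exp
import Mathlib.Analysis.Complex.Exponential
import Mathlib.Tactic

/-!
# Second-order vanishing of Maxwellian means — I: scalar remainder estimates

Route `AntiMazurCoboundaries` of `AtomisticToContinuum/HydrodynamicLimit`, crux
stmt-AtomisticToContinuum-14135 (`CorrectorPressureDecay`), line `almost-invariant-duality`, registered stub
`stub_maxwellianSecondOrder`. This file holds the ELEMENTARY real inequalities behind the pointwise estimate of the
Gaussian likelihood ratio `L_{p,s}(v) = s^{-3/2} exp(‖v‖²/2 − ‖v − p‖²/(2s))` on `ℝ³` against its affine-quadratic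
Taylor part at `(p, s) = (0, 1)`. In the scalar variables `x = ‖v‖²`, `q = ⟨p, v⟩`, `a = ‖p‖`, `s = 1 + t` the
log-likelihood ratio is `h = −(3/2) log(1+t) + x/2 − (x − 2q + a²)/(2(1+t))`, its Taylor part is
`ℓ₀ = q + t(x − 3)/2`, and the main result `scalar_key'` (registered closed form `mso_scalarKey`) is
`|eʰ − 1 − ℓ₀| ≤ (a² + t²) · K_c · e^{cx}` for `a, |t| ≤ c/4`, `0 < c ≤ 1`, `2|q| ≤ a(1 + x)`, with the explicit
constant `K_c = 6e^{3/2}(18 + 16/c²) + 4 + 1/c`. Ingredients: `|eʸ − 1 − y| ≤ 3y²e^{|y|}`,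
`|log(1+t) − t| ≤ 2t²`, `|log(1+t)| ≤ 2|t|` (`|t| ≤ 1/2`), and polynomial-vs-exponential bounds.
The measure-theoretic half (Gaussian change of variables, Fernique, the stub itself) is in
`AntiMazurCoboundariesCorrectorPressureDecayMaxwellianSecondOrder.lean`.
-/

noncomputable section

open Real

namespace Summit.AtomisticToContinuum.HydrodynamicLimit.Theorems.MaxwellianSecondOrder

/-! ## §1 Scalar inequalities -/

/-- `|eˣ − 1 − x| ≤ 3x²e^{|x|}` for every real `x`. [folklore] -/
theorem abs_exp_sub_one_sub_le (x : ℝ) : |exp x - 1 - x| ≤ 3 * x ^ 2 * exp |x| := by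
  have hx2 : 0 ≤ x ^ 2 := sq_nonneg x
  have he1 : 1 ≤ exp |x| := one_le_exp (abs_nonneg x)
  rcases le_or_gt |x| 1 with h | h
  · calc |exp x - 1 - x| ≤ x ^ 2 := abs_exp_sub_one_sub_id_le h
      _ = 1 * x ^ 2 * 1 := by ring
      _ ≤ 3 * x ^ 2 * exp |x| := by gcongr; norm_num
  · have hx1 : 1 ≤ x ^ 2 := by
      have : 1 ≤ |x| ^ 2 := by nlinarith [abs_nonneg x]
      simpa [sq_abs] using this
    have hxx : |x| ≤ x ^ 2 := by
      have : |x| ≤ |x| ^ 2 := by nlinarith [abs_nonneg x]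
      simpa [sq_abs] using this
    have hex : exp x ≤ exp |x| := exp_le_exp.2 (le_abs_self x)
    calc |exp x - 1 - x| ≤ |exp x - 1| + |x| := abs_sub _ _
      _ ≤ |exp x| + |(1 : ℝ)| + |x| := by gcongr; exact abs_sub _ _
      _ = exp x + 1 + |x| := by rw [abs_of_pos (exp_pos x), abs_one]
      _ ≤ x ^ 2 * exp |x| + x ^ 2 * exp |x| + x ^ 2 * exp |x| := by
          gcongr
          · calc exp x ≤ 1 * exp |x| := by rw [one_mul]; exact hex
              _ ≤ x ^ 2 * exp |x| := by gcongr
          · calc (1 : ℝ) = 1 * 1 := by ring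
              _ ≤ x ^ 2 * exp |x| := by gcongr
          · calc |x| = |x| * 1 := by ring
              _ ≤ x ^ 2 * exp |x| := by gcongr
      _ = 3 * x ^ 2 * exp |x| := by ring

/-- `|log(1+t)| ≤ 2|t|` for `|t| ≤ 1/2`. [folklore] -/
theorem abs_log_one_add_le {t : ℝ} (ht : |t| ≤ 1 / 2) : |log (1 + t)| ≤ 2 * |t| := by
  have ht' := abs_le.1 ht
  have hs : 0 < 1 + t := by linarith
  have hup : log (1 + t) ≤ t := by linarith [log_le_sub_one_of_pos hs]
  have hlow : 1 - (1 + t)⁻¹ ≤ log (1 + t) := one_sub_inv_le_log_of_pos hs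
  have hlow' : -(2 * |t|) ≤ 1 - (1 + t)⁻¹ := by
    rw [show 1 - (1 + t)⁻¹ = t / (1 + t) by field_simp; ring, le_div_iff₀ hs]
    rcases abs_cases t with ⟨h1, _⟩ | ⟨h1, _⟩ <;> rw [h1] <;> nlinarith
  exact abs_le.2 ⟨hlow'.trans hlow, hup.trans ((le_abs_self t).trans (by linarith [abs_nonneg t]))⟩

/-- `|log(1+t) − t| ≤ 2t²` for `|t| ≤ 1/2`. [folklore] -/
theorem abs_log_one_add_sub_le {t : ℝ} (ht : |t| ≤ 1 / 2) : |log (1 + t) - t| ≤ 2 * t ^ 2 := by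
  have ht' := abs_le.1 ht
  have hs : 0 < 1 + t := by linarith
  have hup : log (1 + t) ≤ t := by linarith [log_le_sub_one_of_pos hs]
  have hlow : 1 - (1 + t)⁻¹ ≤ log (1 + t) := one_sub_inv_le_log_of_pos hs
  have hlow' : t - 2 * t ^ 2 ≤ 1 - (1 + t)⁻¹ := by
    rw [show 1 - (1 + t)⁻¹ = t / (1 + t) by field_simp; ring, le_div_iff₀ hs]
    nlinarith
  rw [abs_le]
  constructor <;> nlinarith

/-- `x² ≤ (2/a²)·e^{ax}` for `a > 0`, `x ≥ 0`. [folklore] -/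
theorem sq_le_exp_mul {a x : ℝ} (ha : 0 < a) (hx : 0 ≤ x) : x ^ 2 ≤ 2 / a ^ 2 * exp (a * x) := by
  have h := quadratic_le_exp_of_nonneg (mul_nonneg ha.le hx)
  have ha2 : 0 < a ^ 2 := by positivity
  rw [div_mul_eq_mul_div, le_div_iff₀ ha2]
  nlinarith [mul_nonneg ha.le hx]

/-- `x ≤ a⁻¹·e^{ax}` for `a > 0`. [folklore] -/
theorem le_exp_mul {a x : ℝ} (ha : 0 < a) : x ≤ a⁻¹ * exp (a * x) := by
  have h := add_one_le_exp (a * x)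
  rw [← div_eq_inv_mul, le_div_iff₀ ha]
  linarith

/-- `1 ≤ e^{ax}` for `a, x ≥ 0`. [folklore] -/
theorem one_le_exp_mul {a x : ℝ} (ha : 0 ≤ a) (hx : 0 ≤ x) : 1 ≤ exp (a * x) :=
  one_le_exp (mul_nonneg ha hx)

/-- Second-order Taylor remainder of `h`: `|h − ℓ₀| ≤ (a² + t²)(4 + x)` for `a ≤ 1/4`, `|t| ≤ 1/4`,
`2|q| ≤ a(1 + x)`. [folklore] -/
theorem abs_hfun_sub_ell0_le {x q a t : ℝ} (hx : 0 ≤ x) (hq : 2 * |q| ≤ a * (1 + x))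
    (ht : |t| ≤ 1 / 4) : |(-(3 / 2) * log (1 + t) + (x / 2 - (x - 2 * q + a ^ 2) / (2 * (1 + t)))) - (q + t * (x - 3) / 2)| ≤ (a ^ 2 + t ^ 2) * (4 + x) := by
  have ht' := abs_le.1 ht
  have htabs : |t| ≤ 1 / 2 := ht.trans (by norm_num)
  have hs0 : 0 < 1 + t := by linarith
  have hsne : (1 + t) ≠ 0 := hs0.ne'
  have hsinv : (1 + t)⁻¹ ≤ 4 / 3 := by rw [inv_le_comm₀ hs0 (by norm_num)]; linarith
  have hsinv0 : 0 < (1 + t)⁻¹ := inv_pos.2 hs0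
  have hx1 : 0 ≤ 1 + x := by linarith
  have hat : a * |t| ≤ (a ^ 2 + t ^ 2) / 2 := by nlinarith [sq_nonneg (a - |t|), sq_abs t]
  have hq' : |q| ≤ a * (1 + x) / 2 := by linarith
  have hid : (-(3 / 2) * log (1 + t) + (x / 2 - (x - 2 * q + a ^ 2) / (2 * (1 + t)))) - (q + t * (x - 3) / 2) = -(3 / 2) * (log (1 + t) - t) - x / 2 * (t ^ 2 * (1 + t)⁻¹) -
      q * t * (1 + t)⁻¹ - a ^ 2 / 2 * (1 + t)⁻¹ := by
    field_simp
    ring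
  rw [hid]
  have e1 : |-(3 / 2) * (log (1 + t) - t)| ≤ 3 * t ^ 2 := by
    rw [abs_mul, abs_neg, abs_of_pos (by norm_num : (0 : ℝ) < 3 / 2)]
    linarith [abs_log_one_add_sub_le htabs]
  have e2 : |x / 2 * (t ^ 2 * (1 + t)⁻¹)| ≤ 2 / 3 * x * t ^ 2 := by
    rw [abs_of_nonneg (by positivity)]
    calc x / 2 * (t ^ 2 * (1 + t)⁻¹) ≤ x / 2 * (t ^ 2 * (4 / 3)) := by gcongr
      _ = 2 / 3 * x * t ^ 2 := by ring
  have e3 : |q * t * (1 + t)⁻¹| ≤ 1 / 3 * (a ^ 2 + t ^ 2) * (1 + x) := by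
    rw [abs_mul, abs_mul, abs_of_pos hsinv0]
    have hqt : |q| * |t| ≤ (a ^ 2 + t ^ 2) * (1 + x) / 4 := by
      calc |q| * |t| ≤ a * (1 + x) / 2 * |t| := by gcongr
        _ = (1 + x) / 2 * (a * |t|) := by ring
        _ ≤ (1 + x) / 2 * ((a ^ 2 + t ^ 2) / 2) := by gcongr
        _ = (a ^ 2 + t ^ 2) * (1 + x) / 4 := by ring
    calc |q| * |t| * (1 + t)⁻¹ ≤ (a ^ 2 + t ^ 2) * (1 + x) / 4 * (4 / 3) := by gcongr
      _ = 1 / 3 * (a ^ 2 + t ^ 2) * (1 + x) := by ring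
  have e4 : |a ^ 2 / 2 * (1 + t)⁻¹| ≤ 2 / 3 * a ^ 2 := by
    rw [abs_of_nonneg (by positivity)]
    calc a ^ 2 / 2 * (1 + t)⁻¹ ≤ a ^ 2 / 2 * (4 / 3) := by gcongr
      _ = 2 / 3 * a ^ 2 := by ring
  calc |-(3 / 2) * (log (1 + t) - t) - x / 2 * (t ^ 2 * (1 + t)⁻¹) - q * t * (1 + t)⁻¹ -
        a ^ 2 / 2 * (1 + t)⁻¹|
      ≤ |-(3 / 2) * (log (1 + t) - t)| + |x / 2 * (t ^ 2 * (1 + t)⁻¹)| + |q * t * (1 + t)⁻¹| +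
        |a ^ 2 / 2 * (1 + t)⁻¹| := by
        refine (abs_sub _ _).trans ?_
        gcongr
        refine (abs_sub _ _).trans ?_
        gcongr
        exact abs_sub _ _
    _ ≤ 3 * t ^ 2 + 2 / 3 * x * t ^ 2 + 1 / 3 * (a ^ 2 + t ^ 2) * (1 + x) + 2 / 3 * a ^ 2 := by
        linarith
    _ ≤ (a ^ 2 + t ^ 2) * (4 + x) := by
        nlinarith [sq_nonneg a, sq_nonneg t, mul_nonneg (sq_nonneg a) hx, mul_nonneg (sq_nonneg t) hx]

/-- First-order bound on the log-likelihood ratio: `|h| ≤ (|t| + a)(3 + x)` for `a ≤ 1/4`, `|t| ≤ 1/4`,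
`2|q| ≤ a(1 + x)`. [folklore] -/
theorem abs_hfun_le {x q a t : ℝ} (hx : 0 ≤ x) (ha : 0 ≤ a) (ha1 : a ≤ 1 / 4)
    (hq : 2 * |q| ≤ a * (1 + x)) (ht : |t| ≤ 1 / 4) : |(-(3 / 2) * log (1 + t) + (x / 2 - (x - 2 * q + a ^ 2) / (2 * (1 + t))))| ≤ (|t| + a) * (3 + x) := by
  have ht' := abs_le.1 ht
  have htabs : |t| ≤ 1 / 2 := ht.trans (by norm_num)
  have hs0 : 0 < 1 + t := by linarith
  have hsne : (1 + t) ≠ 0 := hs0.ne'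
  have hsinv : (1 + t)⁻¹ ≤ 4 / 3 := by rw [inv_le_comm₀ hs0 (by norm_num)]; linarith
  have hsinv0 : 0 < (1 + t)⁻¹ := inv_pos.2 hs0
  have hx1 : 0 ≤ 1 + x := by linarith
  have hq' : |q| ≤ a * (1 + x) / 2 := by linarith
  have hid2 : (-(3 / 2) * log (1 + t) + (x / 2 - (x - 2 * q + a ^ 2) / (2 * (1 + t)))) = -(3 / 2) * log (1 + t) + x / 2 * (t * (1 + t)⁻¹) + q * (1 + t)⁻¹ -
      a ^ 2 / 2 * (1 + t)⁻¹ := by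
    field_simp
    ring
  rw [hid2]
  have e1 : |-(3 / 2) * log (1 + t)| ≤ 3 * |t| := by
    rw [abs_mul, abs_neg, abs_of_pos (by norm_num : (0 : ℝ) < 3 / 2)]
    linarith [abs_log_one_add_le htabs]
  have e2 : |x / 2 * (t * (1 + t)⁻¹)| ≤ 2 / 3 * x * |t| := by
    rw [abs_mul, abs_mul, abs_of_nonneg (by positivity : (0:ℝ) ≤ x / 2), abs_of_pos hsinv0]
    calc x / 2 * (|t| * (1 + t)⁻¹) ≤ x / 2 * (|t| * (4 / 3)) := by gcongr
      _ = 2 / 3 * x * |t| := by ring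
  have e3 : |q * (1 + t)⁻¹| ≤ 2 / 3 * a * (1 + x) := by
    rw [abs_mul, abs_of_pos hsinv0]
    calc |q| * (1 + t)⁻¹ ≤ a * (1 + x) / 2 * (4 / 3) := by gcongr
      _ = 2 / 3 * a * (1 + x) := by ring
  have e4 : |a ^ 2 / 2 * (1 + t)⁻¹| ≤ 2 / 3 * a := by
    rw [abs_of_nonneg (by positivity)]
    have ha1' : a ≤ 1 := by linarith
    calc a ^ 2 / 2 * (1 + t)⁻¹ ≤ a ^ 2 / 2 * (4 / 3) := by gcongr
      _ = 2 / 3 * (a * a) := by ring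
      _ ≤ 2 / 3 * (a * 1) := by gcongr
      _ = 2 / 3 * a := by ring
  calc |-(3 / 2) * log (1 + t) + x / 2 * (t * (1 + t)⁻¹) + q * (1 + t)⁻¹ - a ^ 2 / 2 * (1 + t)⁻¹|
      ≤ |-(3 / 2) * log (1 + t)| + |x / 2 * (t * (1 + t)⁻¹)| + |q * (1 + t)⁻¹| +
        |a ^ 2 / 2 * (1 + t)⁻¹| := by
        refine (abs_sub _ _).trans ?_
        gcongr
        refine (abs_add_le _ _).trans ?_
        gcongr
        exact abs_add_le _ _
    _ ≤ 3 * |t| + 2 / 3 * x * |t| + 2 / 3 * a * (1 + x) + 2 / 3 * a := by linarith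
    _ ≤ (|t| + a) * (3 + x) := by
        nlinarith [abs_nonneg t, mul_nonneg (abs_nonneg t) hx, mul_nonneg ha hx]

/-- `(3 + x)² ≤ (18 + 16/c²)·e^{(c/2)x}` for `c > 0`, `x ≥ 0`. [folklore] -/
theorem three_add_sq_le {c x : ℝ} (hc : 0 < c) (hx : 0 ≤ x) :
    (3 + x) ^ 2 ≤ (18 + 16 / c ^ 2) * exp (c / 2 * x) := by
  have hc2 : 0 < c / 2 := by linarith
  have q1 : x ^ 2 ≤ 2 / (c / 2) ^ 2 * exp (c / 2 * x) := sq_le_exp_mul hc2 hx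
  have q2 : (1 : ℝ) ≤ exp (c / 2 * x) := one_le_exp_mul hc2.le hx
  have h9 : 2 / (c / 2) ^ 2 = 8 / c ^ 2 := by
    field_simp
    ring
  rw [h9] at q1
  have h10 : (3 + x) ^ 2 ≤ 18 + 2 * x ^ 2 := by nlinarith [sq_nonneg (x - 3)]
  calc (3 + x) ^ 2 ≤ 18 + 2 * x ^ 2 := h10
    _ ≤ 18 * exp (c / 2 * x) + 2 * (8 / c ^ 2 * exp (c / 2 * x)) := by
        have : (18 : ℝ) ≤ 18 * exp (c / 2 * x) := by nlinarith
        linarith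
    _ = (18 + 16 / c ^ 2) * exp (c / 2 * x) := by ring

/-- **The pointwise second-order remainder estimate (scalar form).** With `s = 1 + t`, `x = ‖v‖²`, `q = ⟨p, v⟩`,
`a = ‖p‖`: `|eʰ − 1 − ℓ₀| ≤ (a² + t²)·K_c·e^{cx}` once `a, |t| ≤ c/4 ≤ 1/4` and `2|q| ≤ a(1+x)` (which is
Cauchy–Schwarz). [folklore] -/
theorem scalar_key' {c x q a t : ℝ} (hc : 0 < c) (hc1 : c ≤ 1) (hx : 0 ≤ x) (ha : 0 ≤ a)
    (hq : 2 * |q| ≤ a * (1 + x)) (haη : a ≤ c / 4) (ht : |t| ≤ c / 4) :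
    |exp ((-(3 / 2) * log (1 + t) + (x / 2 - (x - 2 * q + a ^ 2) / (2 * (1 + t))))) - 1 - (q + t * (x - 3) / 2)| ≤ (a ^ 2 + t ^ 2) * ((6 * exp (3 / 2) * (18 + 16 / c ^ 2) + 4 + 1 / c) * exp (c * x)) := by
  have ha4 : a ≤ 1 / 4 := haη.trans (by linarith)
  have ht4 : |t| ≤ 1 / 4 := ht.trans (by linarith)
  have h1 := abs_hfun_sub_ell0_le hx hq ht4
  have h2 := abs_hfun_le hx ha ha4 hq ht4
  -- `|h| ≤ 3/2 + (c/2)x`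
  have hH : (|t| + a) * (3 + x) ≤ 3 / 2 + c / 2 * x := by
    have h5 : |t| + a ≤ c / 2 := by linarith
    have h6 : 0 ≤ |t| + a := by positivity
    calc (|t| + a) * (3 + x) ≤ c / 2 * (3 + x) := by gcongr
      _ = 3 * c / 2 + c / 2 * x := by ring
      _ ≤ 3 / 2 + c / 2 * x := by linarith
  -- Step 3: `|eʰ − 1 − h| ≤ 3h²e^{|h|}`
  have h3 : |exp ((-(3 / 2) * log (1 + t) + (x / 2 - (x - 2 * q + a ^ 2) / (2 * (1 + t))))) - 1 - (-(3 / 2) * log (1 + t) + (x / 2 - (x - 2 * q + a ^ 2) / (2 * (1 + t))))| ≤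
      (a ^ 2 + t ^ 2) * (6 * exp (3 / 2) * (18 + 16 / c ^ 2) * exp (c * x)) := by
    have hsq : (-(3 / 2) * log (1 + t) + (x / 2 - (x - 2 * q + a ^ 2) / (2 * (1 + t)))) ^ 2 ≤ 2 * (a ^ 2 + t ^ 2) * (3 + x) ^ 2 := by
      have h7 : (-(3 / 2) * log (1 + t) + (x / 2 - (x - 2 * q + a ^ 2) / (2 * (1 + t)))) ^ 2 ≤ ((|t| + a) * (3 + x)) ^ 2 := by
        rw [← sq_abs ((-(3 / 2) * log (1 + t) + (x / 2 - (x - 2 * q + a ^ 2) / (2 * (1 + t)))))]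
        gcongr
      have h8 : (|t| + a) ^ 2 ≤ 2 * (a ^ 2 + t ^ 2) := by
        nlinarith [sq_nonneg (|t| - a), sq_abs t]
      calc (-(3 / 2) * log (1 + t) + (x / 2 - (x - 2 * q + a ^ 2) / (2 * (1 + t)))) ^ 2 ≤ ((|t| + a) * (3 + x)) ^ 2 := h7
        _ = (|t| + a) ^ 2 * (3 + x) ^ 2 := by ring
        _ ≤ 2 * (a ^ 2 + t ^ 2) * (3 + x) ^ 2 := by gcongr
    have h3x := three_add_sq_le hc hx
    have hexp : exp |(-(3 / 2) * log (1 + t) + (x / 2 - (x - 2 * q + a ^ 2) / (2 * (1 + t))))| ≤ exp (3 / 2 + c / 2 * x) := exp_le_exp.2 (h2.trans hH)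
    have hee : exp (3 / 2 + c / 2 * x) * exp (c / 2 * x) = exp (3 / 2) * exp (c * x) := by
      rw [← exp_add, ← exp_add]
      ring_nf
    calc |exp ((-(3 / 2) * log (1 + t) + (x / 2 - (x - 2 * q + a ^ 2) / (2 * (1 + t))))) - 1 - (-(3 / 2) * log (1 + t) + (x / 2 - (x - 2 * q + a ^ 2) / (2 * (1 + t))))|
        ≤ 3 * (-(3 / 2) * log (1 + t) + (x / 2 - (x - 2 * q + a ^ 2) / (2 * (1 + t)))) ^ 2 * exp |(-(3 / 2) * log (1 + t) + (x / 2 - (x - 2 * q + a ^ 2) / (2 * (1 + t))))| := abs_exp_sub_one_sub_le _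
      _ ≤ 3 * (2 * (a ^ 2 + t ^ 2) * (3 + x) ^ 2) * exp (3 / 2 + c / 2 * x) := by gcongr
      _ ≤ 3 * (2 * (a ^ 2 + t ^ 2) * ((18 + 16 / c ^ 2) * exp (c / 2 * x))) * exp (3 / 2 + c / 2 * x) := by
          gcongr
      _ = (a ^ 2 + t ^ 2) * (6 * (18 + 16 / c ^ 2)) * (exp (3 / 2 + c / 2 * x) * exp (c / 2 * x)) := by
          ring
      _ = (a ^ 2 + t ^ 2) * (6 * exp (3 / 2) * (18 + 16 / c ^ 2) * exp (c * x)) := by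
          rw [hee]
          ring
  -- Step 4: assemble
  have h4 : (4 + x) ≤ (4 + 1 / c) * exp (c * x) := by
    have q2 : (1 : ℝ) ≤ exp (c * x) := one_le_exp_mul hc.le hx
    have q3 : x ≤ c⁻¹ * exp (c * x) := le_exp_mul hc
    calc 4 + x ≤ 4 * exp (c * x) + c⁻¹ * exp (c * x) := by linarith
      _ = (4 + 1 / c) * exp (c * x) := by rw [one_div]; ring
  have hat2 : 0 ≤ a ^ 2 + t ^ 2 := by positivity
  have hsplit : exp ((-(3 / 2) * log (1 + t) + (x / 2 - (x - 2 * q + a ^ 2) / (2 * (1 + t))))) - 1 - (q + t * (x - 3) / 2) =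
      (exp ((-(3 / 2) * log (1 + t) + (x / 2 - (x - 2 * q + a ^ 2) / (2 * (1 + t))))) - 1 - (-(3 / 2) * log (1 + t) + (x / 2 - (x - 2 * q + a ^ 2) / (2 * (1 + t))))) + ((-(3 / 2) * log (1 + t) + (x / 2 - (x - 2 * q + a ^ 2) / (2 * (1 + t)))) - (q + t * (x - 3) / 2)) := by ring
  rw [hsplit]
  calc |(exp ((-(3 / 2) * log (1 + t) + (x / 2 - (x - 2 * q + a ^ 2) / (2 * (1 + t))))) - 1 - (-(3 / 2) * log (1 + t) + (x / 2 - (x - 2 * q + a ^ 2) / (2 * (1 + t))))) + ((-(3 / 2) * log (1 + t) + (x / 2 - (x - 2 * q + a ^ 2) / (2 * (1 + t)))) - (q + t * (x - 3) / 2))|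
      ≤ |exp ((-(3 / 2) * log (1 + t) + (x / 2 - (x - 2 * q + a ^ 2) / (2 * (1 + t))))) - 1 - (-(3 / 2) * log (1 + t) + (x / 2 - (x - 2 * q + a ^ 2) / (2 * (1 + t))))| + |(-(3 / 2) * log (1 + t) + (x / 2 - (x - 2 * q + a ^ 2) / (2 * (1 + t)))) - (q + t * (x - 3) / 2)| := abs_add_le _ _
    _ ≤ (a ^ 2 + t ^ 2) * (6 * exp (3 / 2) * (18 + 16 / c ^ 2) * exp (c * x)) +
        (a ^ 2 + t ^ 2) * (4 + x) := add_le_add h3 h1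
    _ ≤ (a ^ 2 + t ^ 2) * (6 * exp (3 / 2) * (18 + 16 / c ^ 2) * exp (c * x)) +
        (a ^ 2 + t ^ 2) * ((4 + 1 / c) * exp (c * x)) := by gcongr
    _ = (a ^ 2 + t ^ 2) * ((6 * exp (3 / 2) * (18 + 16 / c ^ 2) + 4 + 1 / c) * exp (c * x)) := by
        ring

/-- **Registered sub-goal `mso_scalarKey` (crux stmt-AtomisticToContinuum-14135, `--supports`): the pointwise
second-order remainder estimate in closed form** — `scalar_key'` with explicit binders. [folklore] -/
theorem mso_scalarKey : ∀ (c x q a t : ℝ), 0 < c → c ≤ 1 → 0 ≤ x → 0 ≤ a → 2 * |q| ≤ a * (1 + x) → a ≤ c / 4 → |t| ≤ c / 4 → |Real.exp (-(3 / 2) * Real.log (1 + t) + (x / 2 - (x - 2 * q + a ^ 2) / (2 * (1 + t)))) - 1 - (q + t * (x - 3) / 2)| ≤ (a ^ 2 + t ^ 2) * ((6 * Real.exp (3 / 2) * (18 + 16 / c ^ 2) + 4 + 1 / c) * Real.exp (c * x)) :=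
  fun _ _ _ _ _ hc hc1 hx ha hq haη ht => scalar_key' hc hc1 hx ha hq haη ht

/-- Exponential bound on the likelihood ratio itself: `eʰ ≤ e^{3/2}·e^{cx}` in the same regime. [folklore] -/
theorem exp_hfun_le {c x q a t : ℝ} (hc1 : c ≤ 1) (hx : 0 ≤ x) (ha : 0 ≤ a)
    (hq : 2 * |q| ≤ a * (1 + x)) (haη : a ≤ c / 4) (ht : |t| ≤ c / 4) :
    exp ((-(3 / 2) * log (1 + t) + (x / 2 - (x - 2 * q + a ^ 2) / (2 * (1 + t))))) ≤ exp (3 / 2) * exp (c * x) := by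
  have ha4 : a ≤ 1 / 4 := haη.trans (by linarith)
  have ht4 : |t| ≤ 1 / 4 := ht.trans (by linarith)
  have h2 := abs_hfun_le hx ha ha4 hq ht4
  have h5 : |t| + a ≤ c / 2 := by linarith
  have h6 : 0 ≤ |t| + a := by positivity
  have hH : (|t| + a) * (3 + x) ≤ 3 / 2 + c * x := by
    calc (|t| + a) * (3 + x) ≤ c / 2 * (3 + x) := by gcongr
      _ = 3 * c / 2 + c / 2 * x := by ring
      _ ≤ 3 / 2 + c * x := by nlinarith
  rw [← exp_add]
  exact exp_le_exp.2 ((le_abs_self _).trans (h2.trans hH))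

/-- Bound on the Taylor part: `|ℓ₀| ≤ 1 + x` for `a ≤ 1/4`, `|t| ≤ 1/4`, `2|q| ≤ a(1+x)`. [folklore] -/
theorem abs_ell0_le {x q a t : ℝ} (hx : 0 ≤ x) (ha1 : a ≤ 1 / 4)
    (hq : 2 * |q| ≤ a * (1 + x)) (ht : |t| ≤ 1 / 4) : |(q + t * (x - 3) / 2)| ≤ 1 + x := by
  have hq' : |q| ≤ (1 + x) / 8 := by nlinarith
  have h2 : |t * (x - 3) / 2| ≤ (x + 3) / 8 := by
    rw [abs_div, abs_mul, abs_two]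
    have : |x - 3| ≤ x + 3 := by
      rw [abs_le]; constructor <;> linarith
    calc |t| * |x - 3| / 2 ≤ 1 / 4 * (x + 3) / 2 := by gcongr
      _ = (x + 3) / 8 := by ring
  calc |q + t * (x - 3) / 2| ≤ |q| + |t * (x - 3) / 2| := abs_add_le _ _
    _ ≤ (1 + x) / 8 + (x + 3) / 8 := add_le_add hq' h2
    _ ≤ 1 + x := by linarith

end Summit.AtomisticToContinuum.HydrodynamicLimit.Theorems.MaxwellianSecondOrder
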